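import Literature.RingTheory.PowerSeries.WeierstrassRootIntegrality
import Mathlib.Analysis.Normed.Group.Ultra
import Mathlib.Analysis.Normed.Field.Ultra
import Mathlib.Analysis.SpecialFunctions.Pow.Real
import HarnessLib

/-!
# The sharp (Newton-polygon) form of the Weierstrass-root integrality lemma: the linear
# coefficient of `T` against the coefficients of `G` when `G(T)` is dominated by its linear term
# (proofs only)

Topic `RingTheory/PowerSeries` (theorems only: no definition, no named fact). Companion of
`WeierstrassRootIntegrality` (`exists_map_eq_of_subst_eq_map`: `[pᵐ]_F(z) ∈ O⟦q⟧ ⇒ z ∈ O⟦q⟧` at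
finite height) for the finite-height route to
`Literature.NumberTheory.EllipticCurves.edixhoven_int_of_neronLattice_eq_smul_periodLattice`
(`NeronIsogenyScaling.lean`, "A finite-height refinement"). That lemma bounds only the
DENOMINATOR of the linear coefficient; the present file bounds its SIZE: over a non-archimedean
field `K`, let `G = Σ_{i≥1} bᵢXⁱ` and `T = Σ_{n≥1} Tₙqⁿ` have coefficients of norm `≤ 1`, and
suppose every coefficient of `S = G(T)` is bounded by the linear one, `‖Sₙ‖ ≤ ‖S₁‖ = ‖b₁T₁‖`.
Then (`norm_coeff_mul_pow_le_of_subst_dominated`) for every `i ≥ 2`,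
`‖bᵢ‖·‖T₁‖ⁱ ≤ ‖b₁‖·‖T₁‖`, i.e. `v(T₁) ≥ (v(b₁) − v(bᵢ))/(i − 1)`: the linear coefficient of `T`
is at least as divisible as the largest slope of the Newton polygon of `G(Z)/Z` — for `G = [p]_F`
of a formal group, as divisible as a `p`-torsion point (root form:
`norm_coeff_one_le_of_root_of_subst_dominated`, `‖T₁‖ ≤ ‖R‖` for a nonzero root `R` of `G` in
the maximal ideal). In the application (`ManinConstantSemistableTwistProofs`, wild case `k ≥ e`)
`T = [p^{m-1}][d′]t''`, `S = θ''([n₁]ψ) ∈ πᵏ·qO⟦q⟧` with `S₁ = πᵏn₁`, so the hypothesis holds,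
and the conclusion `ν − 1 ≥ v(Z(P))` for a `p`-torsion point `P` of the semistable model is
contradicted by the Kraus bounds (`KrausNonMinimalityTwoThreeProofs`) and Vieta on `Ψ₂², Ψ₃`.

Proof (Gauss norm at a real radius `ρ < 1`, no Newton polygon): with `w = maxₙ ‖Tₙ‖ρⁿ` attained
first at `n₀`, the power `Tʲ` has all weighted coefficients `≤ wʲ`, strictly below index `jn₀` and
exactly `wʲ` at `jn₀`; if `‖bᵢ‖‖T₁‖^{i−1} > ‖b₁‖` then for `ρ` close to `1` the index `1` does not
maximise `j ↦ ‖b_j‖wʲ =: Φⱼ`; with `j₀` the least maximiser, the coefficient of `q^{j₀n₀}` in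
`S = Σ b_jTʲ` has weighted norm exactly `M = Φ_{j₀}` (all other contributions are strictly
smaller), whereas the hypothesis gives `≤ ‖S₁‖ρ ≤ ‖b₁‖w = Φ₁ < M`.

## References

* N. Koblitz, *p-adic Numbers, p-adic Analysis, and Zeta-Functions*, 2nd ed., GTM 58 (1984),
  IV.3–IV.4 (Newton polygons of power series; the largest slope and the smallest root). [folklore]
* T. Honda, *On the theory of commutative formal groups*, J. Math. Soc. Japan 22 (1970), 213–246,
  Thm. 2 (the use at finite height). [Honda1970]
-/

noncomputable section

open Finset

namespace Literature.RingTheory.PowerSeries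

open _root_.PowerSeries

section Sharp

variable {K : Type*} [NontriviallyNormedField K] [IsUltrametricDist K]

/-- A finite sum all of whose terms have norm `< C` (`C > 0`) has norm `< C` (ultrametric).
[folklore] -/
theorem norm_sum_lt_of_forall_norm_lt {ι : Type*} (s : Finset ι) (f : ι → K) {C : ℝ}
    (hC : 0 < C) (h : ∀ i ∈ s, ‖f i‖ < C) : ‖∑ i ∈ s, f i‖ < C := by
  rcases s.eq_empty_or_nonempty with rfl | hs
  · simpa using hC
  · exact (hs.norm_sum_le_sup'_norm f).trans_lt ((Finset.sup'_lt_iff hs).mpr h)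

omit [IsUltrametricDist K] in
/-- **Coefficients of a `q`-adic substitution as a finite sum**: for `T ∈ qK⟦q⟧`,
`[qⁿ] G(T) = Σ_{j ≤ n} b_j [qⁿ] Tʲ` (the powers `Tʲ`, `j > n`, do not contribute). [folklore] -/
theorem coeff_subst_eq_sum_range {G T : K⟦X⟧} (hT : constantCoeff T = 0) (n : ℕ) :
    coeff n (G.subst T) = ∑ j ∈ range (n + 1), coeff j G * coeff n (T ^ j) := by
  have h := X_pow_dvd_subst_sub_sum (O := K) (L := K) hT G (n + 1)
  have h0 := (X_pow_dvd_iff.mp h) n (Nat.lt_succ_self n)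
  rw [map_sub, sub_eq_zero, map_sum] at h0
  rw [h0]
  refine sum_congr rfl fun j _ ↦ ?_
  rw [coeff_C_mul]
  rfl

omit [IsUltrametricDist K] in
/-- The linear coefficient of `G(T)` is `b₁T₁` (`G(0) = 0` is not even needed: `[q¹]T⁰ = 0`).
[folklore] -/
theorem coeff_one_subst_eq {G T : K⟦X⟧} (hT : constantCoeff T = 0) :
    coeff 1 (G.subst T) = coeff 1 G * coeff 1 T := by
  rw [coeff_subst_eq_sum_range hT 1, sum_range_succ, sum_range_succ, sum_range_zero, zero_add,
    pow_zero, pow_one, coeff_one, if_neg one_ne_zero, mul_zero, zero_add]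

/-- **Weighted bound for powers.** If `‖Tₙ‖ρⁿ ≤ w` for all `n` (`ρ > 0`), then
`‖[qⁿ]Tʲ‖ρⁿ ≤ wʲ` for all `j, n` (Gauss norm is submultiplicative). [folklore] -/
theorem norm_coeff_pow_mul_pow_le {T : K⟦X⟧} {ρ w : ℝ} (hρ : 0 < ρ)
    (hw : ∀ n, ‖coeff n T‖ * ρ ^ n ≤ w) (j n : ℕ) : ‖coeff n (T ^ j)‖ * ρ ^ n ≤ w ^ j := by
  have hw0 : 0 ≤ w := le_trans (by positivity) (hw 0)
  induction j generalizing n with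
  | zero =>
    rw [pow_zero, pow_zero, coeff_one]
    split_ifs with h
    · subst h; simp
    · simp
  | succ j ih =>
    rw [pow_succ, coeff_mul]
    have hρn : 0 < ρ ^ n := pow_pos hρ n
    have key : ∀ x ∈ antidiagonal n, ‖coeff x.1 (T ^ j) * coeff x.2 T‖ ≤ w ^ (j + 1) / ρ ^ n := by
      intro x hx
      rw [HasAntidiagonal.mem_antidiagonal] at hx
      rw [le_div_iff₀ hρn, norm_mul, ← hx, pow_add,
        show ‖coeff x.1 (T ^ j)‖ * ‖coeff x.2 T‖ * (ρ ^ x.1 * ρ ^ x.2) =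
          (‖coeff x.1 (T ^ j)‖ * ρ ^ x.1) * (‖coeff x.2 T‖ * ρ ^ x.2) by ring, pow_succ]
      exact mul_le_mul (ih x.1) (hw x.2) (by positivity) (pow_nonneg hw0 j)
    have := IsUltrametricDist.norm_sum_le_of_forall_le_of_nonneg (by positivity) key
    rwa [le_div_iff₀ hρn] at this

/-- **Leading weighted coefficient of a power.** If moreover `w > 0` is ATTAINED first at `n₀`
(`‖T_{n₀}‖ρ^{n₀} = w`, `‖Tₙ‖ρⁿ < w` for `n < n₀`), then `Tʲ` has weighted coefficients `< wʲ`
below the index `jn₀` and exactly `wʲ` at `jn₀` (the Gauss norm is multiplicative, with least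
maximising index `jn₀`). [folklore] -/
theorem norm_coeff_pow_lt_and_eq {T : K⟦X⟧} {ρ w : ℝ} (hρ : 0 < ρ) (hw0 : 0 < w)
    (hw : ∀ n, ‖coeff n T‖ * ρ ^ n ≤ w) {n₀ : ℕ} (hn₀ : ‖coeff n₀ T‖ * ρ ^ n₀ = w)
    (hlt : ∀ n < n₀, ‖coeff n T‖ * ρ ^ n < w) (j : ℕ) :
    (∀ a < j * n₀, ‖coeff a (T ^ j)‖ * ρ ^ a < w ^ j) ∧
      ‖coeff (j * n₀) (T ^ j)‖ * ρ ^ (j * n₀) = w ^ j := by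
  induction j with
  | zero =>
    refine ⟨fun a ha ↦ absurd ha (by simp), ?_⟩
    simp [coeff_one]
  | succ j ih =>
    obtain ⟨ihlt, iheq⟩ := ih
    -- the generic strict bound for a term of the convolution below the leading index
    have term_lt : ∀ a b : ℕ, (b < n₀ ∨ a < j * n₀) →
        ‖coeff a (T ^ j) * coeff b T‖ * ρ ^ (a + b) < w ^ (j + 1) := by
      intro a b hab
      rw [norm_mul, pow_add, show ‖coeff a (T ^ j)‖ * ‖coeff b T‖ * (ρ ^ a * ρ ^ b) =
          (‖coeff a (T ^ j)‖ * ρ ^ a) * (‖coeff b T‖ * ρ ^ b) by ring, pow_succ]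
      rcases hab with hb | ha
      · exact mul_lt_mul' (norm_coeff_pow_mul_pow_le hρ hw j a) (hlt b hb) (by positivity)
          (pow_pos hw0 j)
      · rw [mul_comm (w ^ j) w, mul_comm (‖coeff a (T ^ j)‖ * ρ ^ a)]
        exact mul_lt_mul' (hw b) (ihlt a ha) (by positivity) hw0
    refine ⟨fun a ha ↦ ?_, ?_⟩
    · -- every split `a = a' + b` has `b < n₀` or `a' < j n₀`
      rw [pow_succ, coeff_mul]
      have hρa : 0 < ρ ^ a := pow_pos hρ a
      rw [← lt_div_iff₀ hρa]
      refine norm_sum_lt_of_forall_norm_lt _ _ (by positivity) fun x hx ↦ ?_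
      rw [HasAntidiagonal.mem_antidiagonal] at hx
      have hsplit : x.2 < n₀ ∨ x.1 < j * n₀ := by
        by_contra hcon
        rw [not_or, not_lt, not_lt] at hcon
        have : (j + 1) * n₀ ≤ x.1 + x.2 := by rw [Nat.succ_mul]; omega
        omega
      have := term_lt x.1 x.2 hsplit
      rwa [hx, ← lt_div_iff₀ hρa] at this
    · -- at the leading index the split `(j n₀, n₀)` dominates strictly
      rw [pow_succ, coeff_mul]
      set s := antidiagonal ((j + 1) * n₀) with hs
      have hx₀ : (j * n₀, n₀) ∈ s := by rw [hs, HasAntidiagonal.mem_antidiagonal, Nat.succ_mul]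
      rw [← add_sum_erase s _ hx₀]
      have hρa : 0 < ρ ^ ((j + 1) * n₀) := pow_pos hρ _
      have hmain : ‖coeff (j * n₀) (T ^ j) * coeff n₀ T‖ * ρ ^ ((j + 1) * n₀) = w ^ (j + 1) := by
        rw [norm_mul, Nat.succ_mul, pow_add, show ‖coeff (j * n₀) (T ^ j)‖ * ‖coeff n₀ T‖ *
            (ρ ^ (j * n₀) * ρ ^ n₀) = (‖coeff (j * n₀) (T ^ j)‖ * ρ ^ (j * n₀)) *
              (‖coeff n₀ T‖ * ρ ^ n₀) by ring, iheq, hn₀, pow_succ]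
      have hrest : ‖∑ x ∈ s.erase (j * n₀, n₀), coeff x.1 (T ^ j) * coeff x.2 T‖ *
          ρ ^ ((j + 1) * n₀) < w ^ (j + 1) := by
        rw [← lt_div_iff₀ hρa]
        refine norm_sum_lt_of_forall_norm_lt _ _ (by positivity) fun x hx ↦ ?_
        rw [mem_erase, hs, HasAntidiagonal.mem_antidiagonal] at hx
        obtain ⟨hne, hsum⟩ := hx
        have hsplit : x.2 < n₀ ∨ x.1 < j * n₀ := by
          by_contra hcon
          rw [not_or, not_lt, not_lt] at hcon
          rw [Nat.succ_mul] at hsum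
          have h1 : x.1 = j * n₀ := by omega
          have h2 : x.2 = n₀ := by omega
          exact hne (Prod.ext h1 h2)
        have := term_lt x.1 x.2 hsplit
        rwa [hsum, ← lt_div_iff₀ hρa] at this
      have hne : ‖coeff (j * n₀) (T ^ j) * coeff n₀ T‖ ≠
          ‖∑ x ∈ s.erase (j * n₀, n₀), coeff x.1 (T ^ j) * coeff x.2 T‖ := by
        intro h
        rw [h] at hmain
        exact hrest.ne hmain
      rw [IsUltrametricDist.norm_add_eq_max_of_norm_ne_norm hne, max_eq_left, hmain]
      rw [← mul_le_mul_iff_left₀ hρa] at *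
      exact (hrest.trans_le hmain.ge).le

/-- **The sharp lemma (coefficient form).** Let `G, T ∈ K⟦X⟧` have coefficients of norm `≤ 1`,
`G(0) = T(0) = 0`, and suppose every coefficient of `S = G(T)` is dominated by the linear one,
`‖Sₙ‖ ≤ ‖S₁‖` (`S₁ = b₁T₁`). Then for every `i ≥ 2`: `‖bᵢ‖·‖T₁‖ⁱ ≤ ‖b₁‖·‖T₁‖` — i.e.
`v(T₁) ≥ (v(b₁) − v(bᵢ))/(i − 1)`, the largest slope of the Newton polygon of `G(Z)/Z`.
[cite: Honda1970, Thm. 2 (p. 223)] -/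
theorem norm_coeff_mul_pow_le_of_subst_dominated {G T : K⟦X⟧} (hG : ∀ j, ‖coeff j G‖ ≤ 1)
    (hT : ∀ n, ‖coeff n T‖ ≤ 1) (hG0 : constantCoeff G = 0) (hT0 : constantCoeff T = 0)
    (hS : ∀ n, ‖coeff n (G.subst T)‖ ≤ ‖coeff 1 (G.subst T)‖) {i : ℕ} (hi : 2 ≤ i) :
    ‖coeff i G‖ * ‖coeff 1 T‖ ^ i ≤ ‖coeff 1 G‖ * ‖coeff 1 T‖ := by
  by_contra hcon
  rw [not_le] at hcon
  -- notation
  set t1 := ‖coeff 1 T‖ with ht1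
  set bi := ‖coeff i G‖ with hbi
  set b1 := ‖coeff 1 G‖ with hb1
  have ht1pos : 0 < t1 := by
    rcases (norm_nonneg (coeff 1 T)).lt_or_eq with h | h
    · exact h
    · exfalso
      have ht0 : t1 = 0 := h.symm
      rw [ht0, mul_zero, zero_pow (by omega), mul_zero] at hcon
      exact (lt_irrefl _) hcon
  have hbipos : 0 < bi := by
    rcases (norm_nonneg (coeff i G)).lt_or_eq with h | h
    · exact h
    · exfalso
      have hb0 : bi = 0 := h.symm
      rw [hb0, zero_mul] at hcon
      exact absurd hcon (not_lt.mpr (by positivity))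
  -- `b1 < bi * t1^(i-1)`
  obtain ⟨k, rfl⟩ : ∃ k, i = k + 2 := ⟨i - 2, by omega⟩
  have hk1 : k + 2 - 1 = k + 1 := by omega
  have hlt : b1 < bi * t1 ^ (k + 1) := by
    have : b1 * t1 < bi * t1 ^ (k + 1) * t1 := by rw [mul_assoc, ← pow_succ]; exact hcon
    exact lt_of_mul_lt_mul_right this ht1pos.le
  -- the radius `ρ`: `θ < ρ^(k+1) < 1`
  set θ := b1 / (bi * t1 ^ (k + 1)) with hθ
  have hden : 0 < bi * t1 ^ (k + 1) := by positivity
  have hθ1 : θ < 1 := (div_lt_one hden).mpr hlt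
  have hθ0 : 0 ≤ θ := div_nonneg (norm_nonneg _) hden.le
  set r := (1 + θ) / 2 with hr
  have hr0 : 0 < r := by rw [hr]; linarith
  have hr1 : r < 1 := by rw [hr]; linarith
  have hθr : θ < r := by rw [hr]; linarith
  set ρ : ℝ := r ^ ((k + 1 : ℕ) : ℝ)⁻¹ with hρdef
  have hρ0 : 0 < ρ := Real.rpow_pos_of_pos hr0 _
  have hρ1 : ρ < 1 := Real.rpow_lt_one hr0.le hr1 (by positivity)
  have hρk : ρ ^ (k + 1) = r := by
    rw [hρdef, Real.rpow_inv_natCast_pow hr0.le (Nat.succ_ne_zero k)]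
  have hρle1 : ρ ≤ 1 := hρ1.le
  -- the Gauss norm `w` of `T` at radius `ρ`, attained first at `n₀`
  set W : ℕ → ℝ := fun n ↦ ‖coeff n T‖ * ρ ^ n with hW
  have hW1 : W 1 = t1 * ρ := by simp [hW, ht1]
  have hW1pos : 0 < W 1 := by rw [hW1]; positivity
  obtain ⟨N₀, hN₀⟩ : ∃ N₀ : ℕ, ρ ^ N₀ < W 1 := exists_pow_lt_of_lt_one hW1pos hρ1
  have hWsmall : ∀ n, N₀ < n → W n < W 1 := by
    intro n hn
    calc W n ≤ 1 * ρ ^ n := mul_le_mul_of_nonneg_right (hT n) (by positivity)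
      _ = ρ ^ n := one_mul _
      _ ≤ ρ ^ N₀ := pow_le_pow_of_le_one hρ0.le hρle1 hn.le
      _ < W 1 := hN₀
  have hN₀1 : 1 ≤ N₀ := by
    by_contra h
    exact (lt_irrefl _) (hWsmall 1 (by omega))
  have hne : (range (N₀ + 1)).Nonempty := ⟨0, by simp⟩
  set w := (range (N₀ + 1)).sup' hne W with hwdef
  have hWle : ∀ n, W n ≤ w := by
    intro n
    by_cases hn : n ≤ N₀
    · exact le_sup' W (mem_range.mpr (Nat.lt_succ_of_le hn))
    · exact ((hWsmall n (not_le.mp hn)).trans_le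
        (le_sup' W (mem_range.mpr (Nat.lt_succ_of_le hN₀1)))).le
  have hW1le : W 1 ≤ w := hWle 1
  have hwpos : 0 < w := hW1pos.trans_le hW1le
  obtain ⟨n₁, hn₁mem, hn₁⟩ := exists_mem_eq_sup' hne W
  have hex : ∃ n, W n = w := ⟨n₁, by rw [hwdef, hn₁]⟩
  classical
  set n₀ := Nat.find hex with hn₀def
  have hn₀ : W n₀ = w := Nat.find_spec hex
  have hn₀lt : ∀ n < n₀, W n < w := fun n hn ↦
    lt_of_le_of_ne (hWle n) (Nat.find_min hex hn)
  have hn₀pos : 1 ≤ n₀ := by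
    by_contra h
    have h0 : n₀ = 0 := by omega
    rw [h0, hW] at hn₀
    simp only [pow_zero, mul_one, coeff_zero_eq_constantCoeff, hT0, norm_zero] at hn₀
    exact hwpos.ne hn₀
  have hwle : w ≤ ρ := by
    rw [← hn₀]
    calc W n₀ ≤ 1 * ρ ^ n₀ := mul_le_mul_of_nonneg_right (hT n₀) (by positivity)
      _ ≤ ρ ^ 1 := by rw [one_mul]; exact pow_le_pow_of_le_one hρ0.le hρle1 hn₀pos
      _ = ρ := pow_one ρ
  have hw1 : w < 1 := hwle.trans_lt hρ1
  -- the index `1` does not maximise `Φ j = ‖b_j‖ w^j`: `Φ 1 < Φ i`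
  set Φ : ℕ → ℝ := fun j ↦ ‖coeff j G‖ * w ^ j with hΦ
  have hΦ1i : Φ 1 < Φ (k + 2) := by
    simp only [hΦ, pow_one]
    have h1 : t1 * ρ ≤ w := hW1 ▸ hW1le
    have h2 : b1 < bi * (t1 * ρ) ^ (k + 1) := by
      rw [mul_pow, hρk, ← mul_assoc]
      have h := hθr
      rw [hθ, div_lt_iff₀ hden] at h
      linarith
    have h3 : bi * (t1 * ρ) ^ (k + 1) ≤ bi * w ^ (k + 1) :=
      mul_le_mul_of_nonneg_left (pow_le_pow_left₀ (by positivity) h1 _) hbipos.le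
    calc b1 * w < bi * w ^ (k + 1) * w := mul_lt_mul_of_pos_right (h2.trans_le h3) hwpos
      _ = bi * w ^ (k + 2) := by ring
  have hΦipos : 0 < Φ (k + 2) := by simp only [hΦ]; positivity
  -- `Φ` attains its maximum `M`, first at `j₀ ≥ 1`
  obtain ⟨J₁, hJ₁⟩ : ∃ J₁ : ℕ, w ^ J₁ < Φ (k + 2) := exists_pow_lt_of_lt_one hΦipos hw1
  set J := max J₁ (k + 2) with hJdef
  have hΦsmall : ∀ j, J < j → Φ j < Φ (k + 2) := by
    intro j hj
    calc Φ j ≤ 1 * w ^ j := mul_le_mul_of_nonneg_right (hG j) (by positivity)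
      _ = w ^ j := one_mul _
      _ ≤ w ^ J₁ := pow_le_pow_of_le_one hwpos.le hw1.le (by omega)
      _ < Φ (k + 2) := hJ₁
  have hneJ : (range (J + 1)).Nonempty := ⟨0, by simp⟩
  set M := (range (J + 1)).sup' hneJ Φ with hMdef
  have hiJ : k + 2 ∈ range (J + 1) := mem_range.mpr (by omega)
  have hΦiM : Φ (k + 2) ≤ M := le_sup' Φ hiJ
  have hΦle : ∀ j, Φ j ≤ M := by
    intro j
    by_cases hj : j ≤ J
    · exact le_sup' Φ (mem_range.mpr (Nat.lt_succ_of_le hj))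
    · exact ((hΦsmall j (not_le.mp hj)).trans_le hΦiM).le
  have hMpos : 0 < M := hΦipos.trans_le hΦiM
  obtain ⟨j₁, -, hj₁⟩ := exists_mem_eq_sup' hneJ Φ
  have hexJ : ∃ j, Φ j = M := ⟨j₁, by rw [hMdef, hj₁]⟩
  set j₀ := Nat.find hexJ with hj₀def
  have hj₀ : Φ j₀ = M := Nat.find_spec hexJ
  have hj₀lt : ∀ j < j₀, Φ j < M := fun j hj ↦ lt_of_le_of_ne (hΦle j) (Nat.find_min hexJ hj)
  have hΦ1M : Φ 1 < M := hΦ1i.trans_le hΦiM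
  have hj₀pos : 1 ≤ j₀ := by
    by_contra h
    have h0 : j₀ = 0 := by omega
    rw [h0, hΦ] at hj₀
    simp only [pow_zero, mul_one, coeff_zero_eq_constantCoeff, hG0, norm_zero] at hj₀
    exact hMpos.ne hj₀
  -- the coefficient of `q^(j₀ n₀)` of `S = G(T)` has weighted norm exactly `M`
  set ns := j₀ * n₀ with hns
  have hnspos : 1 ≤ ns := Nat.one_le_iff_ne_zero.mpr (Nat.mul_ne_zero (by omega) (by omega))
  have hρns : 0 < ρ ^ ns := pow_pos hρ0 ns
  have hpow := fun j ↦ norm_coeff_pow_lt_and_eq hρ0 hwpos hWle hn₀ hn₀lt j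
  have hSns : ‖coeff ns (G.subst T)‖ * ρ ^ ns = M := by
    rw [coeff_subst_eq_sum_range hT0 ns]
    have hj₀mem : j₀ ∈ range (ns + 1) := by
      rw [mem_range, hns]
      calc j₀ = j₀ * 1 := (mul_one _).symm
        _ ≤ j₀ * n₀ := Nat.mul_le_mul_left _ hn₀pos
        _ < j₀ * n₀ + 1 := Nat.lt_succ_self _
    rw [← add_sum_erase _ _ hj₀mem]
    have hmain : ‖coeff j₀ G * coeff ns (T ^ j₀)‖ * ρ ^ ns = M := by
      rw [norm_mul, mul_assoc, (hpow j₀).2, ← hj₀]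
    have hrest : ‖∑ j ∈ (range (ns + 1)).erase j₀, coeff j G * coeff ns (T ^ j)‖ * ρ ^ ns < M := by
      rw [← lt_div_iff₀ hρns]
      refine norm_sum_lt_of_forall_norm_lt _ _ (by positivity) fun j hj ↦ ?_
      rw [mem_erase] at hj
      obtain ⟨hjne, -⟩ := hj
      rw [lt_div_iff₀ hρns, norm_mul, mul_assoc]
      rcases lt_or_gt_of_ne hjne with hlt' | hgt
      · -- `j < j₀`: `Φ j < M`
        calc ‖coeff j G‖ * (‖coeff ns (T ^ j)‖ * ρ ^ ns) ≤ ‖coeff j G‖ * w ^ j :=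
              mul_le_mul_of_nonneg_left (norm_coeff_pow_mul_pow_le hρ0 hWle j ns) (norm_nonneg _)
          _ < M := hj₀lt j hlt'
      · -- `j > j₀`: `ns < j n₀`, strictly below the leading index of `T^j`
        have hlead : ns < j * n₀ := by
          rw [hns]; exact Nat.mul_lt_mul_of_lt_of_le hgt le_rfl (by omega)
        rcases (norm_nonneg (coeff j G)).lt_or_eq with hbj | hbj
        · calc ‖coeff j G‖ * (‖coeff ns (T ^ j)‖ * ρ ^ ns) < ‖coeff j G‖ * w ^ j :=
                mul_lt_mul_of_pos_left ((hpow j).1 ns hlead) hbj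
            _ ≤ M := hΦle j
        · rw [← hbj, zero_mul]; exact hMpos
    have hne' : ‖coeff j₀ G * coeff ns (T ^ j₀)‖ ≠
        ‖∑ j ∈ (range (ns + 1)).erase j₀, coeff j G * coeff ns (T ^ j)‖ := by
      intro h; rw [h] at hmain; exact hrest.ne hmain
    rw [IsUltrametricDist.norm_add_eq_max_of_norm_ne_norm hne', max_eq_left, hmain]
    rw [← mul_le_mul_iff_left₀ hρns] at *
    exact (hrest.trans_le hmain.ge).le
  -- but `‖S_ns‖ ρ^ns ≤ ‖S₁‖ ρ ≤ ‖b₁‖ w = Φ 1 < M`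
  have h1 : ‖coeff ns (G.subst T)‖ * ρ ^ ns ≤ ‖coeff 1 (G.subst T)‖ * ρ := by
    calc ‖coeff ns (G.subst T)‖ * ρ ^ ns ≤ ‖coeff 1 (G.subst T)‖ * ρ ^ ns :=
          mul_le_mul_of_nonneg_right (hS ns) hρns.le
      _ ≤ ‖coeff 1 (G.subst T)‖ * ρ ^ 1 :=
          mul_le_mul_of_nonneg_left (pow_le_pow_of_le_one hρ0.le hρle1 hnspos) (norm_nonneg _)
      _ = _ := by rw [pow_one]
  have h2 : ‖coeff 1 (G.subst T)‖ * ρ ≤ Φ 1 := by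
    rw [coeff_one_subst_eq hT0, norm_mul]
    simp only [hΦ, pow_one]
    rw [mul_assoc]
    exact mul_le_mul_of_nonneg_left (hW1 ▸ hW1le) (norm_nonneg _)
  have : M < M := by
    calc M = ‖coeff ns (G.subst T)‖ * ρ ^ ns := hSns.symm
      _ ≤ Φ 1 := h1.trans h2
      _ < M := hΦ1M
  exact (lt_irrefl _) this

/-- **The sharp lemma, slope form**: under the same hypotheses, for `i ≥ 2` with `bᵢ ≠ 0` and
`T₁ ≠ 0`, `‖T₁‖^{i-1} ≤ ‖b₁‖/‖bᵢ‖` — in valuations `v(T₁) ≥ (v(b₁) − v(bᵢ))/(i − 1)`, the slope of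
the Newton polygon of `G(Z)/Z` through the vertex `i`. [cite: Honda1970, Thm. 2 (p. 223)] -/
theorem norm_coeff_one_pow_le_div_of_subst_dominated {G T : K⟦X⟧} (hG : ∀ j, ‖coeff j G‖ ≤ 1)
    (hT : ∀ n, ‖coeff n T‖ ≤ 1) (hG0 : constantCoeff G = 0) (hT0 : constantCoeff T = 0)
    (hS : ∀ n, ‖coeff n (G.subst T)‖ ≤ ‖coeff 1 (G.subst T)‖) {i : ℕ} (hi : 2 ≤ i)
    (hbi : coeff i G ≠ 0) (hT1 : coeff 1 T ≠ 0) :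
    ‖coeff 1 T‖ ^ (i - 1) ≤ ‖coeff 1 G‖ / ‖coeff i G‖ := by
  have h := norm_coeff_mul_pow_le_of_subst_dominated hG hT hG0 hT0 hS hi
  have hbi' : 0 < ‖coeff i G‖ := norm_pos_iff.mpr hbi
  have ht1 : 0 < ‖coeff 1 T‖ := norm_pos_iff.mpr hT1
  rw [le_div_iff₀ hbi', mul_comm]
  have : ‖coeff i G‖ * ‖coeff 1 T‖ ^ (i - 1) * ‖coeff 1 T‖ ≤ ‖coeff 1 G‖ * ‖coeff 1 T‖ := by
    rw [mul_assoc, ← pow_succ, Nat.sub_add_cancel (by omega)]; exact h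
  exact le_of_mul_le_mul_right this ht1

/-- **The sharp lemma, root form** (the version used with torsion points). Under the hypotheses of
`norm_coeff_mul_pow_le_of_subst_dominated` with `b₁ ≠ 0`: if `R ≠ 0` satisfies
`‖bᵢ‖ · ‖R‖^{i-1} ≥ ‖b₁‖` for some `i ≥ 2` — which holds for any nonzero root `R` of `G` in the
open unit disc, since in `Σ bⱼRʲ = 0` the term `b₁R` cannot strictly dominate — then
`‖T₁‖ ≤ ‖R‖`: the linear coefficient of `T` is at least as divisible as the torsion point.
[cite: Honda1970, Thm. 2 (p. 223)] -/
theorem norm_coeff_one_le_of_subst_dominated {G T : K⟦X⟧} (hG : ∀ j, ‖coeff j G‖ ≤ 1)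
    (hT : ∀ n, ‖coeff n T‖ ≤ 1) (hG0 : constantCoeff G = 0) (hT0 : constantCoeff T = 0)
    (hS : ∀ n, ‖coeff n (G.subst T)‖ ≤ ‖coeff 1 (G.subst T)‖) (hb1 : coeff 1 G ≠ 0)
    {R : ℝ} (hR : 0 ≤ R) {i : ℕ} (hi : 2 ≤ i) (hroot : ‖coeff 1 G‖ ≤ ‖coeff i G‖ * R ^ (i - 1)) :
    ‖coeff 1 T‖ ≤ R := by
  by_contra hcon
  rw [not_le] at hcon
  have h := norm_coeff_mul_pow_le_of_subst_dominated hG hT hG0 hT0 hS hi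
  have hb1' : 0 < ‖coeff 1 G‖ := norm_pos_iff.mpr hb1
  have hbi : 0 < ‖coeff i G‖ := by
    rcases (norm_nonneg (coeff i G)).lt_or_eq with h' | h'
    · exact h'
    · rw [← h', zero_mul] at hroot; exact absurd hroot (not_le.mpr hb1')
  have ht1 : 0 < ‖coeff 1 T‖ := hR.trans_lt hcon
  -- `‖b₁‖ ≤ ‖bᵢ‖ R^(i-1) < ‖bᵢ‖ ‖T₁‖^(i-1)`, contradicting the coefficient form
  have h1 : ‖coeff i G‖ * R ^ (i - 1) < ‖coeff i G‖ * ‖coeff 1 T‖ ^ (i - 1) :=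
    mul_lt_mul_of_pos_left (pow_lt_pow_left₀ hcon hR (by omega)) hbi
  have h2 : ‖coeff 1 G‖ * ‖coeff 1 T‖ < ‖coeff i G‖ * ‖coeff 1 T‖ ^ i := by
    calc ‖coeff 1 G‖ * ‖coeff 1 T‖ < ‖coeff i G‖ * ‖coeff 1 T‖ ^ (i - 1) * ‖coeff 1 T‖ :=
          mul_lt_mul_of_pos_right (hroot.trans_lt h1) ht1
      _ = ‖coeff i G‖ * ‖coeff 1 T‖ ^ i := by
          rw [mul_assoc, ← pow_succ, Nat.sub_add_cancel (by omega)]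
  exact absurd h (not_le.mpr h2)

/-- **From a root to the index**: if `Σⱼ bⱼ Rʲ` sums to `0` (`‖bⱼ‖ ≤ 1`, `0 < ‖R‖ < 1`, `b₀ = 0`,
`b₁ ≠ 0`), then some `i ≥ 2` has `‖b₁‖ ≤ ‖bᵢ‖·‖R‖^{i-1}` (the term `b₁R` cannot strictly
dominate a null sum). [folklore] -/
theorem exists_norm_coeff_one_le_of_hasSum_zero {G : K⟦X⟧} (hG : ∀ j, ‖coeff j G‖ ≤ 1)
    (hG0 : constantCoeff G = 0) (hb1 : coeff 1 G ≠ 0) {R : K} (hR0 : R ≠ 0) (hR1 : ‖R‖ < 1)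
    (hsum : HasSum (fun j ↦ coeff j G * R ^ j) 0) :
    ∃ i, 2 ≤ i ∧ ‖coeff 1 G‖ ≤ ‖coeff i G‖ * ‖R‖ ^ (i - 1) := by
  by_contra hcon
  push Not at hcon
  have hRpos : 0 < ‖R‖ := norm_pos_iff.mpr hR0
  have hb1pos : 0 < ‖coeff 1 G‖ := norm_pos_iff.mpr hb1
  -- a uniform gap: for `j ≥ J` the terms are tiny, for `2 ≤ j < J` each is strictly smaller
  have hc : 0 < ‖coeff 1 G‖ * ‖R‖ := mul_pos hb1pos hRpos
  obtain ⟨J, hJ⟩ : ∃ J : ℕ, ‖R‖ ^ J < ‖coeff 1 G‖ * ‖R‖ := exists_pow_lt_of_lt_one hc hR1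
  -- the strict bound `C` for all terms `j ≠ 1`
  have hne2 : (Finset.Ico 2 (max J 2)).Nonempty ∨ Finset.Ico 2 (max J 2) = ∅ := by
    rcases (Finset.Ico 2 (max J 2)).eq_empty_or_nonempty with h | h
    · exact Or.inr h
    · exact Or.inl h
  -- define `C` as the max of `‖R‖^J` and the finitely many middle terms
  set mid : ℕ → ℝ := fun j ↦ ‖coeff j G‖ * ‖R‖ ^ j with hmid
  have hmidlt : ∀ j, 2 ≤ j → mid j < ‖coeff 1 G‖ * ‖R‖ := by
    intro j hj
    have := hcon j hj
    calc mid j = ‖coeff j G‖ * ‖R‖ ^ (j - 1) * ‖R‖ := by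
          simp only [hmid]; rw [mul_assoc, ← pow_succ, Nat.sub_add_cancel (by omega)]
      _ < ‖coeff 1 G‖ * ‖R‖ := mul_lt_mul_of_pos_right this hRpos
  obtain ⟨C, hCpos, hClt, hCbound⟩ : ∃ C : ℝ, 0 < C ∧ C < ‖coeff 1 G‖ * ‖R‖ ∧
      ∀ j, j ≠ 1 → ‖coeff j G * R ^ j‖ ≤ C := by
    rcases hne2 with hne | hempty
    · set C₁ := (Finset.Ico 2 (max J 2)).sup' hne mid with hC₁
      refine ⟨max C₁ (‖R‖ ^ J), lt_max_of_lt_right (pow_pos hRpos J),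
        max_lt ((Finset.sup'_lt_iff hne).mpr fun j hj ↦ hmidlt j (Finset.mem_Ico.mp hj).1) hJ,
        fun j hj ↦ ?_⟩
      rcases Nat.lt_or_ge j 2 with hj2 | hj2
      · have hj0 : j = 0 := by omega
        subst hj0
        rw [pow_zero, mul_one, coeff_zero_eq_constantCoeff, hG0, norm_zero]
        exact le_max_of_le_right (pow_nonneg hRpos.le J)
      rcases Nat.lt_or_ge j (max J 2) with hjJ | hjJ
      · exact le_max_of_le_left ((le_sup' mid (Finset.mem_Ico.mpr ⟨hj2, hjJ⟩)).trans_eq'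
          (by rw [hmid, norm_mul, norm_pow]))
      · refine le_max_of_le_right ?_
        rw [norm_mul, norm_pow]
        calc ‖coeff j G‖ * ‖R‖ ^ j ≤ 1 * ‖R‖ ^ j := mul_le_mul_of_nonneg_right (hG j) (by positivity)
          _ ≤ ‖R‖ ^ J := by rw [one_mul]; exact pow_le_pow_of_le_one hRpos.le hR1.le (le_of_max_le_left hjJ)
    · refine ⟨‖R‖ ^ J, pow_pos hRpos J, hJ, fun j hj ↦ ?_⟩
      rcases Nat.lt_or_ge j 2 with hj2 | hj2
      · have hj0 : j = 0 := by omega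
        subst hj0
        rw [pow_zero, mul_one, coeff_zero_eq_constantCoeff, hG0, norm_zero]
        exact pow_nonneg hRpos.le J
      · have hJ2 : max J 2 ≤ j := by
          have : ¬ j < max J 2 := fun h ↦ by
            have : j ∈ Finset.Ico 2 (max J 2) := Finset.mem_Ico.mpr ⟨hj2, h⟩
            rw [hempty] at this; exact absurd this (Finset.notMem_empty _)
          omega
        rw [norm_mul, norm_pow]
        calc ‖coeff j G‖ * ‖R‖ ^ j ≤ 1 * ‖R‖ ^ j := mul_le_mul_of_nonneg_right (hG j) (by positivity)
          _ ≤ ‖R‖ ^ J := by rw [one_mul]; exact pow_le_pow_of_le_one hRpos.le hR1.le (le_of_max_le_left hJ2)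
  -- the sum without the `j = 1` term has norm `≤ C`, yet it equals `-(b₁ R)`
  have hsplit := hsum.summable.tsum_eq_add_tsum_ite 1
  rw [hsum.tsum_eq] at hsplit
  have hle : ‖∑' n, ite (n = 1) 0 (coeff n G * R ^ n)‖ ≤ C := by
    refine IsUltrametricDist.norm_tsum_le_of_forall_le_of_nonneg hCpos.le fun j ↦ ?_
    split_ifs with h
    · rw [norm_zero]; exact hCpos.le
    · exact hCbound j h
  have heq : ‖coeff 1 G * R ^ 1‖ = ‖∑' n, ite (n = 1) 0 (coeff n G * R ^ n)‖ := by
    rw [eq_neg_of_add_eq_zero_left hsplit.symm, norm_neg]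
  rw [pow_one, norm_mul] at heq
  exact absurd (heq ▸ hle) (not_le.mpr hClt)

end Sharp

end Literature.RingTheory.PowerSeries
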